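import Summits.AtomisticToContinuum.BoseEinsteinCondensation.Theorems.BECInsertionCorrectorStaticResponseBoundThomsonReduction
import Summits.AtomisticToContinuum.BoseEinsteinCondensation.Theorems.StaticResponseBound.Negative.UvThomsonFlowReduction
import Literature.MathematicalPhysics.QuantumManyBody.PeriodicBoseGasScatteringODE
import HarnessLib

/-!
# The force-wave dress is a bijection: stub S5 `stub_uvForceWaveBound` ⟺ the UV susceptibility bound

Line `uv-thomson-force-wave` of crux `BECInsertionCorrector.StaticResponseBound`
(stmt-AtomisticToContinuum-12057). The registered heart S5 asks, for every weakly modulated positive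
ground state `Φ` of the truncated gas on the ultraviolet window `Λρa ≤ |p|²`, for an `H₋₁(|Φ|²)` bound
`K·N` on its centred FORCE-DENSITY WAVE `Q_Φ − Q̄`. By Thomson's principle (the landed stub S4,
`stub_thomsonReduction`) and its converse (`Negative.UvThomsonFlow.forceWave_le_of_susceptibility_pos`,
landed by the drefute seat) this is EQUIVALENT, with constants `K ↦ (1 + √K)²` in both directions, to
the `t → 0` content of the crux's UV half for the same family: the static-susceptibility bound
`‖∑ⱼcos(p·xⱼ) − ⟨∑cos⟩_Φ‖²_{H₋₁(|Φ|²)} ≤ K·N/|p|²`. This file records that equivalence at the level of the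
fully quantified statements (`uvForceWaveBound_iff_uvSusceptibilityBound`), so that the open
obligation can be promoted to a crux item in either dress. Both sides are written out in tree
vocabulary (no new definitions). [card uv-thomson-force-wave; KipnisLandim1999 App. 1 §6]
-/

noncomputable section

namespace Summit.AtomisticToContinuum.BoseEinsteinCondensation.Cruxes.StaticResponseBound.UvThomsonForceWave

open MeasureTheory Filter
open scoped ENNReal NNReal BigOperators
open Literature.MathematicalPhysics.QuantumManyBody.BoseGas
open Summit.AtomisticToContinuum.BoseEinsteinCondensation.Theses.BECInsertionCorrector
open Summit.AtomisticToContinuum.BoseEinsteinCondensation.Theorems.StaticResponseBound.Negative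

/-- `(√N + √(K N))² = (1 + √K)² N`. [folklore] -/
theorem sqrt_add_sqrt_mul_sq' (K : ℝ) (N : ℕ) :
    (Real.sqrt N + Real.sqrt (K * N)) ^ 2 = (1 + Real.sqrt K) ^ 2 * N := by
  have hN : (0 : ℝ) ≤ N := Nat.cast_nonneg N
  rw [Real.sqrt_mul' K hN]
  have hsN : Real.sqrt N ^ 2 = N := Real.sq_sqrt hN
  calc (Real.sqrt N + Real.sqrt K * Real.sqrt N) ^ 2
      = (1 + Real.sqrt K) ^ 2 * Real.sqrt N ^ 2 := by ring
    _ = (1 + Real.sqrt K) ^ 2 * N := by rw [hsN]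

/-- **S5 ⟺ UV susceptibility bound** (registered sub-goal `uvForceWaveBound_iff_uvSusceptibilityBound`).
Left: the registered text of stub `stub_uvForceWaveBound` (force-wave dress). Right: the same family of
weakly modulated positive ground states of `v_n = min(v,n)` on the window `Λρa ≤ |p|²`, with the
conclusion replaced by the centred static-susceptibility bound
`hMinusOneSqW L |Φ| (∑ⱼcos(p·xⱼ) − cosMean) ≤ K N/|p|²`. `→`: Thomson's principle `stub_thomsonReduction`
with `B = K N` gives `(√N + √(KN))²/|p|² = (1+√K)²N/|p|²`. `←`: the converse
`forceWave_le_of_susceptibility_pos` with `B = K N/|p|²` gives `(√N + √(|p|²·KN/|p|²))² = (1+√K)²N`.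
[cite: KipnisLandim1999, App. 1 §6 (6.1)] -/
theorem uvForceWaveBound_iff_uvSusceptibilityBound :
    (∀ v : ℝ → ℝ≥0∞, IsRepulsiveFiniteRange v →
      ∃ Λ : ℝ, 1 ≤ Λ ∧ ∃ ρ₁ : ℝ, 0 < ρ₁ ∧ ∃ K : ℝ, 0 ≤ K ∧ ∃ n₀ : ℕ, ∀ n : ℕ, n₀ ≤ n →
      ∀ ρ : ℝ, 0 < ρ → ρ < ρ₁ → ∀ N : ℕ, 1 ≤ N → ∀ k : Fin 3 → ℤ, k ≠ 0 →
      Λ * (ρ * (scatteringLength v).toReal) ≤ psq (sideLength ρ N) k →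
      ∀ s : ℝ, s ^ 2 ≤ psq (sideLength ρ N) k *
      (periodicGroundStateEnergy (truncPotential v n) N (sideLength ρ N)).toReal / N →
      ∀ Φ : PeriodicTrialState N (sideLength ρ N),
      (∀ X, Φ.ψ X = (‖Φ.ψ X‖ : ℂ)) → (∀ X, Φ.ψ X ≠ 0) →
      periodicEnergy (truncPotential v n) Φ ≠ ⊤ →
      (∀ Ψ : PeriodicTrialState N (sideLength ρ N), periodicEnergy (truncPotential v n) Ψ ≠ ⊤ →
      (periodicEnergy (truncPotential v n) Φ).toReal + s * cosMean (sideLength ρ N) k Φ ≤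
      (periodicEnergy (truncPotential v n) Ψ).toReal + s * cosMean (sideLength ρ N) k Ψ) →
      hMinusOneSqW (sideLength ρ N) (fun X => ‖Φ.ψ X‖)
      (fun X => ((∑ j : Fin N, Real.sin (2 * Real.pi / sideLength ρ N * ∑ i, (k i : ℝ) * X j i) *
      ∑ i : Fin 3, ((k i : ℝ) / Real.sqrt (∑ l, (k l : ℝ) ^ 2)) *
      pderiv j i (fun Y => ‖Φ.ψ Y‖ ^ 2) X) / ‖Φ.ψ X‖ ^ 2) -
      ∫ Y in cellN N (sideLength ρ N), ((∑ j : Fin N, Real.sin (2 * Real.pi / sideLength ρ N * ∑ i, (k i : ℝ) * Y j i) *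
      ∑ i : Fin 3, ((k i : ℝ) / Real.sqrt (∑ l, (k l : ℝ) ^ 2)) *
      pderiv j i (fun Y => ‖Φ.ψ Y‖ ^ 2) Y) / ‖Φ.ψ Y‖ ^ 2) * ‖Φ.ψ Y‖ ^ 2)
      ≤ ENNReal.ofReal (K * N)) ↔
    (∀ v : ℝ → ℝ≥0∞, IsRepulsiveFiniteRange v →
      ∃ Λ : ℝ, 1 ≤ Λ ∧ ∃ ρ₁ : ℝ, 0 < ρ₁ ∧ ∃ K : ℝ, 0 ≤ K ∧ ∃ n₀ : ℕ, ∀ n : ℕ, n₀ ≤ n →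
      ∀ ρ : ℝ, 0 < ρ → ρ < ρ₁ → ∀ N : ℕ, 1 ≤ N → ∀ k : Fin 3 → ℤ, k ≠ 0 →
      Λ * (ρ * (scatteringLength v).toReal) ≤ psq (sideLength ρ N) k →
      ∀ s : ℝ, s ^ 2 ≤ psq (sideLength ρ N) k *
      (periodicGroundStateEnergy (truncPotential v n) N (sideLength ρ N)).toReal / N →
      ∀ Φ : PeriodicTrialState N (sideLength ρ N),
      (∀ X, Φ.ψ X = (‖Φ.ψ X‖ : ℂ)) → (∀ X, Φ.ψ X ≠ 0) →
      periodicEnergy (truncPotential v n) Φ ≠ ⊤ →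
      (∀ Ψ : PeriodicTrialState N (sideLength ρ N), periodicEnergy (truncPotential v n) Ψ ≠ ⊤ →
      (periodicEnergy (truncPotential v n) Φ).toReal + s * cosMean (sideLength ρ N) k Φ ≤
      (periodicEnergy (truncPotential v n) Ψ).toReal + s * cosMean (sideLength ρ N) k Ψ) →
      hMinusOneSqW (sideLength ρ N) (fun X => ‖Φ.ψ X‖)
      (fun X => (∑ j, Real.cos (2 * Real.pi / sideLength ρ N * ∑ i, (k i : ℝ) * X j i)) -
      cosMean (sideLength ρ N) k Φ)
      ≤ ENNReal.ofReal (K * N / psq (sideLength ρ N) k)) := by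
  constructor
  · -- force-wave bound ⇒ susceptibility bound (Thomson's principle, S4)
    intro h v hv
    obtain ⟨Λ, hΛ, ρ₁, hρ₁, K, hK, n₀, hUV⟩ := h v hv
    refine ⟨Λ, hΛ, ρ₁, hρ₁, (1 + Real.sqrt K) ^ 2, by positivity, n₀, ?_⟩
    intro n hn ρ hρ hρ1 N hN k hk hwin s hs Φ hreal hpos hfin hmin
    have hL : 0 < sideLength ρ N := sideLength_pos hρ hN
    have hQ := hUV n hn ρ hρ hρ1 N hN k hk hwin s hs Φ hreal hpos hfin hmin
    have hT := stub_thomsonReduction N (sideLength ρ N) hL k hk Φ (K * N) (by positivity) hQ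
    rwa [sqrt_add_sqrt_mul_sq' K N] at hT
  · -- susceptibility bound ⇒ force-wave bound (converse, drefute g2)
    intro h v hv
    obtain ⟨Λ, hΛ, ρ₁, hρ₁, K, hK, n₀, hχ⟩ := h v hv
    refine ⟨Λ, hΛ, ρ₁, hρ₁, (1 + Real.sqrt K) ^ 2, by positivity, n₀, ?_⟩
    intro n hn ρ hρ hρ1 N hN k hk hwin s hs Φ hreal hpos hfin hmin
    have hL : 0 < sideLength ρ N := sideLength_pos hρ hN
    have hp : 0 < psq (sideLength ρ N) k := UvThomsonFlow.psq_pos hL.ne' hk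
    have hV := hχ n hn ρ hρ hρ1 N hN k hk hwin s hs Φ hreal hpos hfin hmin
    have hC := UvThomsonFlow.forceWave_le_of_susceptibility_pos N (sideLength ρ N) hL k hk Φ hreal hpos
      (K * N / psq (sideLength ρ N) k) (by positivity) hV
    have hconst : (Real.sqrt N + Real.sqrt (psq (sideLength ρ N) k * (K * N / psq (sideLength ρ N) k))) ^ 2
        = (1 + Real.sqrt K) ^ 2 * N := by
      rw [mul_div_cancel₀ _ hp.ne', sqrt_add_sqrt_mul_sq' K N]
    rw [hconst] at hC
    simpa only [UvThomsonStubs.forceWave, UvThomsonStubs.khat] using hC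

end Summit.AtomisticToContinuum.BoseEinsteinCondensation.Cruxes.StaticResponseBound.UvThomsonForceWave

end
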